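import Literature.NumberTheory.Automorphic.HermitianLatticesLocal
import HarnessLib

/-!
# The hyperbolic plane adapted to two unimodular Hermitian lattices; splitting it off
# (O'Meara §82F; Jacobowitz 1962 §§4–5; the lattice proof of the Cartan decomposition)

Topic `NumberTheory/Automorphic`; namespace `Literature.NumberTheory.Automorphic.HermitianLattice`.
One `Prop`-valued structure (`IsHyperbolicPair`), three plumbing definitions (`orth`, `orthInt`, `proj`)
and fully proved theorems; no named fact, no `sorry`. Sequel of `HermitianLatticesLocal` (same setting:
`Valued K ℤᵐ⁰`, involution `σ`, `σ`-fixed uniformiser `ϖ`, `2 ∈ 𝒪ˣ`, Hensel — `LocalConjDatum σ ϖ` — or the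
dyadic-capable `UnramifiedLocalConjDatum σ ϖ`; a
`σ`-Hermitian form `B : V →ₛₗ[σ] V →ₗ[K] K`; unimodular lattices `IsUnimodularLattice B W L`).

* `exists_adapted_hyperbolicPair` — **the key step**: for unimodular lattices `L, M` in the same space `W`
  with `M ⊄ L` there are `a ≥ 1` and a HYPERBOLIC PAIR `x, y ∈ L` (`B x x = B y y = 0`, `B x y = 1`)
  with `ϖ^{-a} x ∈ M`, `ϖ^{a} y ∈ M`. (Take `m ∈ M` of maximal level `a`, so `x₀ = ϖ^a m ∈ L` is
  primitive; a partner `y₀ ∈ L`, `B x₀ y₀ = 1`, by self-duality; then `ϖ^a y₀ ∈ M` by self-duality of `M`;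
  exact isotropy: `x = x₀ + α y₀` with `α = -c/(1+s)`, `s² = 1 - cq` the Hensel root `≡ 1`
  (`c = B x₀ x₀ ∈ 𝔭^{2a}`, `q = B y₀ y₀`), then `y = u⁻¹(y₀ + β x)`, `β = -q/(2u)`, `u = B x y₀ = 1 + αq`.)
  `UnramifiedLocalConjDatum.exists_adapted_hyperbolicPair` — the same for the dyadic-capable datum
  `UnramifiedLocalConjDatum σ ϖ` ((trace) + (norm) instead of `2 ∈ 𝒪ˣ` + Hensel): `α` solves
  `c + α + σα + q α σ(α) = 0` (`exists_isotropic_coeff`, a norm equation), `β = -q t/σ(u)` with `t + σ t = 1`;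
  the `LocalConjDatum` statement is its specialisation along `LocalConjDatum.toUnramified`.
* `IsUnimodularLattice.restrict` — a hyperbolic pair `x, y` INSIDE a unimodular lattice `N ⊆ W` splits
  it: `N' = N ∩ ⟨x,y⟩^⊥` is unimodular in `W ∩ ⟨x,y⟩^⊥` and `N = (𝒪x + 𝒪y) ⊔ N'` (projection
  `proj z = z - (B y z) x - (B x z) y`); `finrank_inf_orth_lt` (the dimension drops), `orth_smul`.

Iterating (`L ↝ L'`, `M ↝ M'` with the pairs `(x, y)` and `(ϖ^{-a}x, ϖ^{a}y)`, same orthogonal) gives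
the simultaneous hyperbolic splitting of a pair of unimodular lattices = the elementary-divisor /
Cartan decomposition statement for hyperspecial unitary groups (cell hodgecm-mathlib, row IV-9, line
`b4-hyperspecial-gelfand-pair`, sub-stubs (2b) `CartanAntidiag` and (2L) `LocalSymmetric`).

References: O. T. O'Meara, *Introduction to Quadratic Forms* (1963), §42D (hyperbolic planes), §82F
(unimodular lattices, 82:15) [Omeara1963]; R. Jacobowitz, *Hermitian forms over local fields*, Amer. J.
Math. 84 (1962), §§4–5, §7 (unramified dyadic) [Jacobowitz1962].
-/

noncomputable section

open scoped Valued WithZero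

namespace Literature.NumberTheory.Automorphic.HermitianLattice

variable {K : Type*} [Field K]
variable {V : Type*} [AddCommGroup V] [Module K V] {σ : K →+* K} {ϖ : K}
variable {B : V →ₛₗ[σ] V →ₗ[K] K}

/-! ## §1 Hyperbolic pairs -/

/-- A (normalised) **hyperbolic pair** for `B`: `B x x = B y y = 0`, `B x y = 1`. [cite: Omeara1963, §42D] -/
structure IsHyperbolicPair (B : V →ₛₗ[σ] V →ₗ[K] K) (x y : V) : Prop where
  /-- `x` is isotropic -/
  left : B x x = 0
  /-- `y` is isotropic -/
  right : B y y = 0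
  /-- `B x y = 1` -/
  pair : B x y = 1

namespace IsHyperbolicPair

variable {x y : V}

/-- `B y x = 1`. [cite: Omeara1963, §42D] -/
theorem pair' (hB : IsHermitianForm B) (h : IsHyperbolicPair B x y) : B y x = 1 := hB.eq_one_comm h.pair

/-- The swapped pair is hyperbolic. [cite: Omeara1963, §42D] -/
theorem symm (hB : IsHermitianForm B) (h : IsHyperbolicPair B x y) : IsHyperbolicPair B y x :=
  ⟨h.right, h.left, h.pair' hB⟩

/-- Rescaling a hyperbolic pair by a `σ`-fixed `t ≠ 0`: `(t⁻¹ x, t y)`. [cite: Omeara1963, §42D] -/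
theorem smul (h : IsHyperbolicPair B x y) {t : K} (ht : t ≠ 0) (hσt : σ t = t) :
    IsHyperbolicPair B (t⁻¹ • x) (t • y) := by
  refine ⟨?_, ?_, ?_⟩
  · rw [form_smul_left, form_smul_right, h.left, mul_zero, mul_zero]
  · rw [form_smul_left, form_smul_right, h.right, mul_zero, mul_zero]
  · rw [form_smul_left, form_smul_right, h.pair, mul_one, map_inv₀, hσt, inv_mul_cancel₀ ht]

/-- `x` and `y` are not orthogonal. [cite: Omeara1963, §42D] -/
theorem ne_zero_left (hB : IsHermitianForm B) (h : IsHyperbolicPair B x y) : B y x ≠ 0 := by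
  rw [h.pair' hB]; exact one_ne_zero

end IsHyperbolicPair

/-! ## §2 The hyperbolic plane adapted to two unimodular lattices -/

section Adapted

variable [Valued K ℤᵐ⁰]

/-- **Adapted hyperbolic plane — every residue characteristic** (datum `UnramifiedLocalConjDatum σ ϖ`:
`σ`-fixed uniformiser, (trace), (norm); the dyadic unramified case included).  Let `L, M` be unimodular lattices in
the same space `W` with `M ⊄ L`.  Then there are `a ≥ 1` and a hyperbolic pair `x, y ∈ L` (`B x x = B y y = 0`,
`B x y = 1`) with `ϖ^{-a} x ∈ M` and `ϖ^{a} y ∈ M`.  Proof: `m ∈ M` of maximal level `a`, `x₀ = ϖ^a m ∈ L`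
primitive, partner `y₀ ∈ L` (`B x₀ y₀ = 1`); exact isotropy of `x = x₀ + α y₀` where `α` solves
`c + α + σ α + q α σ(α) = 0` with `v α ≤ v c` (`c = B x₀ x₀ ∈ 𝔭^{2a}`, `q = B y₀ y₀`;
`UnramifiedLocalConjDatum.exists_isotropic_coeff` — a norm equation instead of the Hensel square root), then
`y = u⁻¹ (y₀ + β x)` with `u = B x y₀ = 1 + σ(α) q` and `β = -q t / σ(u)`, `t + σ t = 1` (the trace element instead
of `½`). [cite: Jacobowitz1962, §§4–5 and §7] -/
theorem UnramifiedLocalConjDatum.exists_adapted_hyperbolicPair {W : Submodule K V} {L M : Submodule 𝒪[K] V}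
    (hd : UnramifiedLocalConjDatum σ ϖ) (hB : IsHermitianForm B)
    (hL : IsUnimodularLattice B W L) (hM : IsUnimodularLattice B W M) (h : ¬ M ≤ L) :
    ∃ (a : ℕ) (x y : V), 1 ≤ a ∧ IsHyperbolicPair B x y ∧ x ∈ L ∧ y ∈ L ∧
      (ϖ ^ a)⁻¹ • x ∈ M ∧ (ϖ ^ a) • y ∈ M := by
  obtain ⟨a, ha1, haM, m, hm, hprim⟩ := hL.exists_primitive_of_not_le' hd.vϖ hM h
  -- the `σ`-fixed scalar `P = ϖ^a ∈ 𝔪` (made opaque)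
  have hσP : σ (ϖ ^ a) = ϖ ^ a := hd.σ_pow a
  have hvP1 : Valued.v (ϖ ^ a) < 1 := by
    rw [v_lt_one_iff, hd.v_pow, WithZero.exp_le_exp]; omega
  have hP0 : ϖ ^ a ≠ 0 := pow_ne_zero _ hd.ϖ_ne_zero
  obtain ⟨P, hPdef⟩ : ∃ P : K, ϖ ^ a = P := ⟨_, rfl⟩
  rw [hPdef] at hσP hvP1 hP0 hprim
  simp only [hPdef] at haM
  -- the trace element `t + σ t = 1`
  obtain ⟨t, hvt, htt⟩ := hd.trace
  -- `x₀ := P • m ∈ L` primitive, partner `y₀`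
  obtain ⟨x₀, hx₀def⟩ : ∃ x₀ : V, P • m = x₀ := ⟨_, rfl⟩
  have hx₀ : x₀ ∈ L := hx₀def ▸ haM m hm
  rw [hx₀def] at hprim
  obtain ⟨y₀, hy₀, hxy⟩ := hL.exists_apply_eq_one_of_not_mem' hd.vϖ hd.vσ hB hx₀ hprim
  have hyx : B y₀ x₀ = 1 := hB.eq_one_comm hxy
  -- `n := P • y₀ ∈ M`
  have hn : P • y₀ ∈ M := by
    refine hM.dual _ (W.smul_mem _ (hL.le_span hy₀)) fun m' hm' => ?_
    rw [form_smul_right, ← hσP, ← form_smul_left]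
    exact hL.integral _ (haM m' hm') _ hy₀
  -- the scalars `p = B m m`, `q = B y₀ y₀`, `c = B x₀ x₀ = P² p` (made opaque)
  obtain ⟨p, hpdef⟩ : ∃ p : K, B m m = p := ⟨_, rfl⟩
  obtain ⟨q, hqdef⟩ : ∃ q : K, B y₀ y₀ = q := ⟨_, rfl⟩
  obtain ⟨c, hcdef⟩ : ∃ c : K, B x₀ x₀ = c := ⟨_, rfl⟩
  have hvp : Valued.v p ≤ 1 := hpdef ▸ hM.integral m hm m hm
  have hvq : Valued.v q ≤ 1 := hqdef ▸ hL.integral y₀ hy₀ y₀ hy₀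
  have hσq : σ q = q := hqdef ▸ hB.apply_self y₀
  have hσc : σ c = c := hcdef ▸ hB.apply_self x₀
  have hc : c = P * (P * p) := by
    rw [← hcdef, ← hpdef, ← hx₀def, form_smul_left, form_smul_right, hσP]
  have hvPP : Valued.v c ≤ Valued.v (P * P) := by
    rw [hc, map_mul, map_mul, map_mul]
    calc Valued.v P * (Valued.v P * Valued.v p) ≤ Valued.v P * (Valued.v P * 1) :=
          mul_le_mul' le_rfl (mul_le_mul' le_rfl hvp)
      _ = Valued.v P * Valued.v P := by rw [mul_one]
  have hvc : Valued.v c < 1 := by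
    refine lt_of_le_of_lt hvPP ?_
    rw [map_mul]
    calc Valued.v P * Valued.v P ≤ Valued.v P * 1 := mul_le_mul' le_rfl hvP1.le
      _ < 1 := by rw [mul_one]; exact hvP1
  -- the isotropy coefficient: `c + α + σ α + q α σ(α) = 0`, `v α ≤ v c`; `x₁ := x₀ + α y₀` is isotropic
  obtain ⟨α, hvα, hα⟩ := hd.exists_isotropic_coeff hσc hσq hvq hvc
  have hvα1 : Valued.v α ≤ 1 := hvα.trans hvc.le
  obtain ⟨x₁, hx₁⟩ : ∃ x₁ : V, x₀ + α • y₀ = x₁ := ⟨_, rfl⟩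
  have hx₁L : x₁ ∈ L := hx₁ ▸ L.add_mem hx₀ (smul_mem_of_v_le L hvα1 hy₀)
  have hx₁x₁ : B x₁ x₁ = 0 := by
    have hexp : B x₁ x₁ = c + α + σ α + q * (α * σ α) := by
      rw [← hx₁]
      simp only [map_add, LinearMap.add_apply, form_smul_left B α, form_smul_right B α, hxy, hyx, hcdef, hqdef]
      ring
    rw [hexp, hα]
  -- `u := B x₁ y₀ = 1 + σ(α) q`, a unit (not necessarily `σ`-fixed)
  obtain ⟨u, hudef⟩ : ∃ u : K, 1 + σ α * q = u := ⟨_, rfl⟩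
  have hu : B x₁ y₀ = u := by
    rw [← hx₁, ← hudef, map_add, LinearMap.add_apply, form_smul_left B α, hxy, hqdef]
  have hvu : Valued.v u = 1 := by
    rw [← hudef]
    refine Valuation.map_one_add_of_lt _ ?_
    rw [map_mul, hd.vσ]
    calc Valued.v α * Valued.v q ≤ Valued.v c * 1 := mul_le_mul' hvα hvq
      _ < 1 := by rw [mul_one]; exact hvc
  have hu0 : u ≠ 0 := fun h0 => by rw [h0, map_zero] at hvu; exact zero_ne_one hvu
  have hσu0 : σ u ≠ 0 := (map_ne_zero σ).2 hu0
  have hvσu : Valued.v (σ u) = 1 := by rw [hd.vσ, hvu]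
  have hyx₁ : B y₀ x₁ = σ u := by rw [← hB x₁ y₀, hu]
  -- `β := -(q t) / σ(u)`; `y₁ := y₀ + β x₁` is isotropic with `B x₁ y₁ = u`
  obtain ⟨β, hβ⟩ : ∃ β : K, -(q * t) / σ u = β := ⟨_, rfl⟩
  have hvβ : Valued.v β ≤ 1 := by
    rw [← hβ, map_div₀, Valuation.map_neg, map_mul, hvσu, div_one]
    calc Valued.v q * Valued.v t ≤ 1 * 1 := mul_le_mul' hvq hvt
      _ = 1 := mul_one 1
  have hβu : β * σ u = -(q * t) := by rw [← hβ]; exact div_mul_cancel₀ _ hσu0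
  have hσβu : σ β * u = -(q * σ t) := by
    have hh := congrArg σ hβu
    rwa [map_mul, hd.σσ, map_neg, map_mul, hσq] at hh
  obtain ⟨y₁, hy₁⟩ : ∃ y₁ : V, y₀ + β • x₁ = y₁ := ⟨_, rfl⟩
  have hy₁L : y₁ ∈ L := hy₁ ▸ L.add_mem hy₀ (smul_mem_of_v_le L hvβ hx₁L)
  have hy₁y₁ : B y₁ y₁ = 0 := by
    have hexp : B y₁ y₁ = q + β * σ u + σ β * u := by
      rw [← hy₁]
      simp only [map_add, LinearMap.add_apply, form_smul_left B β, form_smul_right B β, hyx₁, hu, hx₁x₁, hqdef]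
      ring
    rw [hexp, hβu, hσβu]
    linear_combination (-q) * htt
  have hx₁y₁ : B x₁ y₁ = u := by
    rw [← hy₁, map_add, form_smul_right, hu, hx₁x₁, mul_zero, add_zero]
  -- `y₂ := u⁻¹ y₁`
  have hvu' : Valued.v u⁻¹ ≤ 1 := by rw [map_inv₀, hvu, inv_one]
  have hy₂L : u⁻¹ • y₁ ∈ L := smul_mem_of_v_le L hvu' hy₁L
  have hpair : IsHyperbolicPair B x₁ (u⁻¹ • y₁) := by
    refine ⟨hx₁x₁, ?_, ?_⟩
    · rw [form_smul_left, form_smul_right, hy₁y₁, mul_zero, mul_zero]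
    · rw [form_smul_right, hx₁y₁, inv_mul_cancel₀ hu0]
  -- memberships in `M`: `α = γ P²` with `γ` integral
  have hPP0 : P * P ≠ 0 := mul_ne_zero hP0 hP0
  obtain ⟨γ, hγ⟩ : ∃ γ : K, α / (P * P) = γ := ⟨_, rfl⟩
  have hvγ : Valued.v γ ≤ 1 := by
    rw [← hγ, map_div₀, div_le_one₀ (zero_lt_iff.2 ((Valuation.ne_zero_iff _).2 hPP0))]
    exact hvα.trans hvPP
  have hPα : P⁻¹ * α = γ * P := by
    rw [← hγ]
    field_simp
  have hxM : P⁻¹ • x₁ ∈ M := by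
    have : P⁻¹ • x₁ = m + γ • (P • y₀) := by
      rw [← hx₁, smul_add, ← hx₀def, smul_smul, inv_mul_cancel₀ hP0, one_smul, smul_smul, hPα,
        smul_smul]
    rw [this]
    exact M.add_mem hm (smul_mem_of_v_le M hvγ hn)
  have hvPβP : Valued.v (P * β * P) ≤ 1 := by
    rw [map_mul, map_mul]
    calc Valued.v P * Valued.v β * Valued.v P ≤ 1 * 1 * 1 :=
          mul_le_mul' (mul_le_mul' hvP1.le hvβ) hvP1.le
      _ = 1 := by rw [mul_one, mul_one]
  have hyM : P • (u⁻¹ • y₁) ∈ M := by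
    have : P • (u⁻¹ • y₁) = u⁻¹ • (P • y₀ + (P * β * P) • (P⁻¹ • x₁)) := by
      rw [smul_comm P u⁻¹, ← hy₁, smul_add, smul_smul, smul_smul, mul_inv_cancel_right₀ hP0]
    rw [this]
    exact smul_mem_of_v_le M hvu' (M.add_mem hn (smul_mem_of_v_le M hvPβP hxM))
  refine ⟨a, x₁, u⁻¹ • y₁, ha1, hpair, hx₁L, hy₂L, ?_, ?_⟩
  · rw [hPdef]; exact hxM
  · rw [hPdef]; exact hyM

/-- **Adapted hyperbolic plane.** Let `L, M` be unimodular lattices in the same space `W` with `M ⊄ L`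
(datum: `σ`-fixed uniformiser `ϖ`, `2 ∈ 𝒪ˣ`, Hensel). Then there are `a ≥ 1` and a hyperbolic pair
`x, y ∈ L` (`B x x = B y y = 0`, `B x y = 1`) with `ϖ^{-a} x ∈ M` and `ϖ^{a} y ∈ M`: the first step of the
simultaneous splitting `L = (𝒪x ⊕ 𝒪y) ⊥ L'`, `M = (𝒪ϖ^{-a}x ⊕ 𝒪ϖ^{a}y) ⊥ M'` behind the invariants of a
pair of unimodular Hermitian lattices / the Cartan decomposition of the hyperspecial unitary group.
The non-dyadic datum is an unramified datum (`LocalConjDatum.toUnramified`: `t = ½`, Hensel square roots give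
the norms), so this is the special case of `UnramifiedLocalConjDatum.exists_adapted_hyperbolicPair`.
[cite: Jacobowitz1962, §§4–5] -/
theorem exists_adapted_hyperbolicPair {W : Submodule K V} {L M : Submodule 𝒪[K] V}
    (hd : LocalConjDatum σ ϖ) (hB : IsHermitianForm B)
    (hL : IsUnimodularLattice B W L) (hM : IsUnimodularLattice B W M) (h : ¬ M ≤ L) :
    ∃ (a : ℕ) (x y : V), 1 ≤ a ∧ IsHyperbolicPair B x y ∧ x ∈ L ∧ y ∈ L ∧
      (ϖ ^ a)⁻¹ • x ∈ M ∧ (ϖ ^ a) • y ∈ M :=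
  hd.toUnramified.exists_adapted_hyperbolicPair hB hL hM h

end Adapted

/-! ## §3 Splitting off a hyperbolic plane contained in a unimodular lattice -/

section Restrict

variable (B)

/-- The `B`-orthogonal of the plane `⟨x, y⟩`: `{z | B x z = 0 ∧ B y z = 0}`. [cite: Omeara1963, §42D] -/
def orth (x y : V) : Submodule K V := LinearMap.ker (B x) ⊓ LinearMap.ker (B y)

/-- The projection `z ↦ z - (B y z) x - (B x z) y` onto the orthogonal of a hyperbolic plane `⟨x, y⟩`.
[cite: Omeara1963, §42D] -/
def proj (x y : V) : V →ₗ[K] V := LinearMap.id - (B y).smulRight x - (B x).smulRight y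

variable {B} {x y z : V}

/-- Membership in `orth`. [cite: Omeara1963, §42D] -/
theorem mem_orth : z ∈ orth B x y ↔ B x z = 0 ∧ B y z = 0 := by
  simp only [orth, Submodule.mem_inf, LinearMap.mem_ker]

/-- `proj z = z - (B y z) x - (B x z) y`. [cite: Omeara1963, §42D] -/
theorem proj_apply (z : V) : proj B x y z = z - B y z • x - B x z • y := by
  simp only [proj, LinearMap.sub_apply, LinearMap.id_apply, LinearMap.smulRight_apply]

/-- `proj` lands in the orthogonal of a hyperbolic plane. [cite: Omeara1963, §42D] -/
theorem proj_mem_orth (hB : IsHermitianForm B) (hp : IsHyperbolicPair B x y) (z : V) :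
    proj B x y z ∈ orth B x y := by
  rw [mem_orth, proj_apply]
  refine ⟨?_, ?_⟩
  · rw [map_sub, map_sub, form_smul_right, form_smul_right, hp.left, hp.pair]; ring
  · rw [map_sub, map_sub, form_smul_right, form_smul_right, hp.right, hp.pair' hB]; ring

/-- `proj` is the identity on the orthogonal. [cite: Omeara1963, §42D] -/
theorem proj_eq_self (hz : z ∈ orth B x y) : proj B x y z = z := by
  rw [proj_apply, (mem_orth.1 hz).1, (mem_orth.1 hz).2, zero_smul, zero_smul, sub_zero, sub_zero]

/-- `z = ((B y z) x + (B x z) y) + proj z`. [cite: Omeara1963, §42D] -/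
theorem eq_add_proj (z : V) : z = (B y z • x + B x z • y) + proj B x y z := by
  rw [proj_apply]; abel

/-- Pairing with an orthogonal vector only sees the orthogonal component. [cite: Omeara1963, §42D] -/
theorem form_eq_form_proj (hz : z ∈ orth B x y) (w : V) : B w z = B (proj B x y w) z := by
  obtain ⟨hxz, hyz⟩ := mem_orth.1 hz
  rw [proj_apply, map_sub, map_sub, LinearMap.sub_apply, LinearMap.sub_apply, form_smul_left,
    form_smul_left, hxz, hyz, mul_zero, mul_zero, sub_zero, sub_zero]

/-- Orthogonal vectors pair to zero on the other side too. [cite: Omeara1963, §42D] -/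
theorem form_eq_zero_of_mem_orth (hB : IsHermitianForm B) (hz : z ∈ orth B x y) :
    B z x = 0 ∧ B z y = 0 :=
  ⟨hB.eq_zero_comm.1 (mem_orth.1 hz).1, hB.eq_zero_comm.1 (mem_orth.1 hz).2⟩

/-- Rescaling the pair does not change the orthogonal. [cite: Omeara1963, §42D] -/
theorem orth_smul {t t' : K} (ht : t ≠ 0) (ht' : t' ≠ 0) : orth B (t • x) (t' • y) = orth B x y := by
  have h1 : σ t ≠ 0 := (map_ne_zero σ).2 ht
  have h2 : σ t' ≠ 0 := (map_ne_zero σ).2 ht'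
  simp only [orth, LinearMap.map_smulₛₗ, LinearMap.ker_smul _ _ h1, LinearMap.ker_smul _ _ h2]

/-- Splitting the plane decreases the dimension (for inductions). [cite: Omeara1963, §42D] -/
theorem finrank_inf_orth_lt {W : Submodule K V} [FiniteDimensional K W] (hB : IsHermitianForm B)
    (hp : IsHyperbolicPair B x y) (hx : x ∈ W) :
    Module.finrank K ↥(W ⊓ orth B x y) < Module.finrank K W := by
  refine Submodule.finrank_lt_finrank_of_lt (lt_of_le_of_ne inf_le_left fun h => ?_)
  have : x ∈ W ⊓ orth B x y := h.symm ▸ hx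
  exact hp.ne_zero_left hB (mem_orth.1 this.2).2

variable [Valued K ℤᵐ⁰]

variable (B) in
/-- The orthogonal of the plane as an `𝒪`-submodule. [cite: Omeara1963, §82F] -/
def orthInt (x y : V) : Submodule 𝒪[K] V := (orth B x y).restrictScalars 𝒪[K]

/-- Membership in `orthInt`. [cite: Omeara1963, §82F] -/
theorem mem_orthInt : z ∈ orthInt B x y ↔ B x z = 0 ∧ B y z = 0 := by
  rw [orthInt, Submodule.restrictScalars_mem, mem_orth]

/-- Rescaling the pair does not change `orthInt`. [cite: Omeara1963, §82F] -/
theorem orthInt_smul {t t' : K} (ht : t ≠ 0) (ht' : t' ≠ 0) :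
    orthInt B (t • x) (t' • y) = orthInt B x y := by
  rw [orthInt, orthInt, orth_smul ht ht']

/-- **Splitting a hyperbolic plane off a unimodular lattice.** If the hyperbolic pair `x, y` lies in the
unimodular lattice `N ⊆ W`, then `N' := N ∩ ⟨x, y⟩^⊥` is a unimodular lattice in `W ∩ ⟨x, y⟩^⊥` and
`N = (𝒪x + 𝒪y) ⊕ N'`. [cite: Omeara1963, §82F (82:15)] -/
theorem IsUnimodularLattice.restrict {W : Submodule K V} {N : Submodule 𝒪[K] V}
    (hB : IsHermitianForm B) (hN : IsUnimodularLattice B W N) (hp : IsHyperbolicPair B x y)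
    (hx : x ∈ N) (hy : y ∈ N) :
    IsUnimodularLattice B (W ⊓ orth B x y) (N ⊓ orthInt B x y) ∧
      N = Submodule.span 𝒪[K] {x, y} ⊔ (N ⊓ orthInt B x y) := by
  have hprojN : ∀ z ∈ N, proj B x y z ∈ N := fun z hz => by
    rw [proj_apply]
    exact N.sub_mem (N.sub_mem hz (smul_mem_of_v_le N (hN.integral y hy z hz) hx))
      (smul_mem_of_v_le N (hN.integral x hx z hz) hy)
  have hmem : ∀ z ∈ N, proj B x y z ∈ N ⊓ orthInt B x y := fun z hz =>
    ⟨hprojN z hz, mem_orthInt.2 (mem_orth.1 (proj_mem_orth hB hp z))⟩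
  have heq : N ⊓ orthInt B x y = N.map ((proj B x y).restrictScalars 𝒪[K]) := by
    ext z
    constructor
    · rintro ⟨hzN, hzo⟩
      exact ⟨z, hzN, proj_eq_self (mem_orth.2 (mem_orthInt.1 hzo))⟩
    · rintro ⟨w, hw, rfl⟩
      exact hmem w hw
  refine ⟨⟨?_, ?_, ?_, ?_⟩, ?_⟩
  · rw [heq]; exact hN.fg.map _
  · apply le_antisymm
    · rw [Submodule.span_le]
      rintro z ⟨hzN, hzo⟩
      exact ⟨hN.le_span hzN, mem_orth.2 (mem_orthInt.1 hzo)⟩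
    · rintro z ⟨hzW, hzo⟩
      have hz' : z ∈ (Submodule.span K (N : Set V)).map (proj B x y) := by
        rw [hN.span_eq]; exact ⟨z, hzW, proj_eq_self hzo⟩
      rw [Submodule.map_span] at hz'
      refine Submodule.span_mono ?_ hz'
      rintro _ ⟨w, hw, rfl⟩
      exact hmem w hw
  · intro z hz z' hz'
    exact hN.integral z hz.1 z' hz'.1
  · intro z hz h
    have hzo : z ∈ orth B x y := hz.2
    have hzN : z ∈ N := hN.dual z hz.1 fun w hw => by
      rw [form_eq_form_proj hzo w]
      exact h _ (hmem w hw)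
    exact ⟨hzN, mem_orthInt.2 (mem_orth.1 hzo)⟩
  · apply le_antisymm
    · intro z hz
      rw [eq_add_proj (B := B) (x := x) (y := y) z]
      refine Submodule.add_mem_sup (Submodule.add_mem _ ?_ ?_) (hmem z hz)
      · exact smul_mem_of_v_le _ (hN.integral y hy z hz) (Submodule.subset_span (Set.mem_insert x {y}))
      · exact smul_mem_of_v_le _ (hN.integral x hx z hz)
          (Submodule.subset_span (Set.mem_insert_of_mem x (Set.mem_singleton y)))
    · refine sup_le ?_ inf_le_left
      rw [Submodule.span_le]
      rintro w (rfl | rfl)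
      · exact hx
      · exact hy

end Restrict

end Literature.NumberTheory.Automorphic.HermitianLattice

end
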